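/-
Copyright (c) 2026 the pub-hodgecm-mathlib formalisation cell (harness21).  Prover seat hodgecm-mathlib-K2E3-p29 (g2): Track B «K2-LIT», hLiu418 = stmt-HodgeConjecture-24832;
socket #41, Road Φ organ Φ5 ∕ KIND W (iii-fin-Φ5); KW desk F0P2-p08 (g3) word 23:40:35Z, cc LEAD F0P6-plan (g14).  THEOREMS ONLY (no `def`, no `instance`, no notation,
no named-fact hypothesis, no `sorry`).
-/
import Summits.HodgeConjecture.HodgeConjecture.Theorems.K2LiuBadPlaceLocalFactorSkew        -- ★ Φ5-tie `K2LiuBadPlaceWhittakerEntire` + ★ B3 Tate letters + ★ `exists_hasConductorExp_adeleAddCharAt`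
import Summits.HodgeConjecture.HodgeConjecture.Theorems.K2LiuBadPlaceWhittakerData          -- ★ Φ5 data: `exists_skewUnit`, `exists_two_threshold`, `exists_mball_neg`
import HarnessLib

/-!
# Crux `HLiu418`, Road Φ organ Φ5 — `K2LiuBadPlaceWhittakerRightTranslate`: ★ Φ5's TWO CONCLUSIONS (far-shell stability for every `s`; the ball integral is entire) FOR A
# RIGHT-TRANSLATED LOCAL SIEGEL-SECTION FAMILY, with every piece of auxiliary data DISCHARGED (generic frame `(F, E, c, δ, T, JD)`)

Cell `hodgecm-mathlib`, crux item hLiu418 = `stmt-HodgeConjecture-24832` (helper lane `--supports … --as helper`, count-neutral), route of record `HCCMUnconditional`; squad K2 ∕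
K2Liu, road `K2_Liu`, socket #41, Road Φ organ Φ5 «bad finite places» serving KIND W (iii-fin).  ★ Φ5 `K2LiuBadPlaceWhittakerEntire.whittaker_setIntegral_ball_eq` (Karel's lemma) and
`differentiable_whittaker` (entire ball integrals) take a local Siegel-section family `f` of a fixed open level together with FOUR pieces of auxiliary data (`ε, c_ε, c₂, b_T`), an additive
character `ψ` with a conductor exponent, a trace `τ` with three letters, a Haar measure `μF` of `F_v`, and, per index, exponents `b ≥ 2b_T`, `b′`.  The KIND-W local letter of record
★ p863154 `kindWFfin` integrates the factor at `(w_Δ)_v · y · h_v` — a RIGHT TRANSLATE by `x := h_v`.  THIS FILE (one theorem) serves exactly that shape, in the generic frame where the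
binder telescope is cheap:
* **`whittaker_ball_letters_rightTranslate`** — for `χ_v` trivial near `1` (`hχv`), `f : ℂ → H(F_v) → ℂ` local Siegel sections (`hf`) of a fixed open level `U` (`hU`, `hfU`), continuous
  (`hfc`), entire in `s` (`hdiff`), locally-in-`s` uniformly bounded on compacts (`hbd`), a `T`-skew index block `β` with `β β⁻ = 1` (`hβs`, `hββ`) and ANY `x ∈ H(F_v)`:
  `∃ K : ℕ, (∀ s, ∀ k ≥ K, ∫_{B(−k)} f s (w_Δ n(t) x) ψ_{F,v}(−Tr tr(β t)) dμ = ∫_{B(−K)} …) ∧ Differentiable ℂ (s ↦ ∫_{B(−K)} …)` for ANY additive Haar measure `μ` on the Skew carrier,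
  with Tate's `ψ_{F,v} = adeleAddCharAt F v` and `Tr = Algebra.trace F_v (E ⊗ F_v)`.  PROOF: the right translate `g ↦ f s (g x)` is again Siegel (`mul_assoc`), of level `x U x⁻¹`
  (`Subgroup.comap (MulAut.conj x⁻¹)`, open), continuous, entire, and bounded on the compact image of each ball (★ F3b `isCompact_ball` ∕ `continuous_pullback`); `μF := addHaar`; the
  conductor exponent ★ `exists_hasConductorExp_adeleAddCharAt`; the trace letters ★ B3 `toLocalRing_algebraTrace` ∕ `algebraTrace_toLocalRing_mul` ∕ `continuous_algebraTrace_localRing`;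
  `ε, c_ε` ★ `exists_skewUnit`, `c₂` ★ `exists_two_threshold`, `b_T, b, b′` ★ `exists_mball_neg` (+ ★ `mball_antitone`); `K := (K₁ + 4b + 2b′ − 1)⁺`.
[Casselman1980, §3], [KudlaRallis1994, §2], [Shimura1997, §18.3–18.4], [CasselsFrohlichANT1967, Ch. XV §2.2].
HONEST LABEL.  Count-neutral helper, closes no socket: `HC_CM` is proved only modulo the 7 printed citations (2 remaining named inputs: hLiu418 = `stmt-HodgeConjecture-24832`, h413 =
`stmt-HodgeConjecture-24833`) until rung 0 closes.

## References
* [Casselman1980] W. Casselman, *The unramified principal series of p-adic groups I*, Compositio Math. 40 (1980): §3 (Karel's lemma: the Whittaker integral is a compact-ball integral).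
* [KudlaRallis1994] S. Kudla, S. Rallis, *A regularized Siegel–Weil formula: the first term identity*, Ann. of Math. 140 (1994): §2 (local Whittaker integrals of Siegel sections are entire).
* [Shimura1997] G. Shimura, *Euler products and Eisenstein series*, CBMS 93 (1997): §18.3–18.4.
* [CasselsFrohlichANT1967] J. Tate, in Cassels–Fröhlich (eds.), *Algebraic Number Theory* (1967): Ch. XV §2.2 (local components of `ψ`, conductor).
-/

set_option autoImplicit false
-- the mandated namespace repeats the single-problem summit's segment (`HodgeConjecture.HodgeConjecture`)
set_option linter.dupNamespace false

noncomputable section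

open scoped Matrix NNReal ENNReal Topology
open NumberField IsDedekindDomain MeasureTheory Measure Filter Set Metric
open Literature.NumberTheory.Automorphic Literature.NumberTheory.Automorphic.UnitaryGroup Literature.NumberTheory.GaloisRepresentations
open Literature.NumberTheory.GelbartRogawski1991 Literature.NumberTheory.GelbartRogawski1991.AdaptedBlocks
open Literature.NumberTheory.GelbartRogawski1991.UnitaryDualPair
open Literature.NumberTheory.K2Lit Literature.NumberTheory.K2Lit.LocalSiegelDoubled
open Summit.HodgeConjecture.HodgeConjecture.Cruxes.HLiu418.K2LiuLocalRingValuationBalls (mball_antitone)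
open Summit.HodgeConjecture.HodgeConjecture.Cruxes.HLiu418.K2LiuBadPlaceWhittakerData (exists_skewUnit exists_two_threshold exists_mball_neg)
open Summit.HodgeConjecture.HodgeConjecture.Cruxes.HLiu418.K2LiuTateCharacterLocalTrace
open Summit.HodgeConjecture.HodgeConjecture.Cruxes.HLiu418.K2LiuBadPlaceWhittakerEntire (whittaker_setIntegral_ball_eq differentiable_whittaker)
open Summit.HodgeConjecture.HodgeConjecture.Cruxes.HLiu418.K2LiuBadPlaceLocalFactorSkew (exists_hasConductorExp_adeleAddCharAt)

namespace Summit.HodgeConjecture.HodgeConjecture.Cruxes.HLiu418.K2LiuBadPlaceWhittakerRightTranslate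

variable (F : Type) [Field F] [NumberField F] (E : Type) [Field E] [NumberField E] [Algebra F E]
  [Algebra.IsQuadraticExtension F E] (c : E ≃ₐ[F] E)
  {δ : E} (hcδ : c δ = -δ) (hδ : δ ≠ 0) {dd : F} (hd : δ * δ = algebraMap F E dd)
  (w : HeightOneSpectrum (𝓞 F)) (k₀ : ℕ) {T : Matrix (Fin k₀) (Fin k₀) F} (hT : T.IsSymm) (hTd : IsUnit T.det)
  {JD : Matrix (Fin (k₀ + k₀)) (Fin (k₀ + k₀)) E} (hJD : JD = (LocalSplitting.gramD F k₀ T).map (algebraMap F E))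
  {ϖ : w.adicCompletion F} (hϖ : Valued.v ϖ = WithZero.exp (-1 : ℤ))

include hcδ hδ hd hT hTd hJD hϖ in
/-- **★ Φ5 FOR A RIGHT-TRANSLATED FAMILY, AUXILIARY DATA DISCHARGED** (generic frame `(F, E, c, δ, T, JD)`, Skew carrier `S` with an additive Haar measure `μ`).  For a local character family
`χ_v` trivial near `1` (`hχv`), a family `f : ℂ → H(F_v) → ℂ` of local Siegel sections (`hf`) of a fixed open level `U` (`hU`, `hfU`), continuous (`hfc`), entire in `s` (`hdiff`) and
locally-in-`s` uniformly bounded on compacts (`hbd`), a `T`-skew index block `β` with `β β⁻ = 1` (`hβs`, `hββ`), and ANY `x ∈ H(F_v)`: there is `K : ℕ` with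
`∀ s, ∀ k ≥ K, ∫_{B(−k)} f s (w_Δ n(t) x) ψ_{F,v}(−Tr tr(β t)) dμ = ∫_{B(−K)} …` and `s ↦ ∫_{B(−K)} …` `Differentiable ℂ` — ★ `whittaker_setIntegral_ball_eq` ∕ ★ `differentiable_whittaker` for the
right-translated family `g ↦ f s (g x)` (again Siegel; level `x U x⁻¹`; continuous; entire; bounded on the compact image of the ball, ★ F3b `isCompact_ball` ∕ `continuous_pullback`), with
`μF := addHaar`, Tate's `ψ_{F,v} = adeleAddCharAt F v` (★ `exists_hasConductorExp_adeleAddCharAt`, `Tr = Algebra.trace`: ★ B3 `toLocalRing_algebraTrace` ∕ `algebraTrace_toLocalRing_mul` ∕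
`continuous_algebraTrace_localRing`), and the exponents `ε, c_ε, c₂, b_T, b ≥ 2b_T, b′` from ★ Φ5-data; `K := (K₁ + 4b + 2b′ − 1)⁺`.
[cite: Casselman1980, §3] [cite: KudlaRallis1994, §2] [cite: Shimura1997, §18.3–18.4] -/
theorem whittaker_ball_letters_rightTranslate
    (S : AddSubgroup (Matrix (Fin k₀) (Fin k₀) (LocalRing E w)))
    (hS : ∀ t, t ∈ S ↔ (t.map (conjLocal E c w))ᵀ * LocalSplitting.gramS F E w k₀ T + LocalSplitting.gramS F E w k₀ T * t = 0)
    [MeasurableSpace S] [BorelSpace S] [LocallyCompactSpace S] (μ : Measure S) [μ.IsAddHaarMeasure] [μ.Regular]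
    {χv : ∀ w' : UnitaryGroup.PlacesOver E w, (w'.1.adicCompletion E)ˣ →* ℂˣ}
    (hχv : ∀ w' : UnitaryGroup.PlacesOver E w, ∃ V ∈ 𝓝 (1 : w'.1.adicCompletion E), ∀ z ∈ V, ∀ hz : IsUnit z, χv w' hz.unit = 1)
    {U : Subgroup (UnitaryGroup.localPi E c (k₀ + k₀) JD w)} (hU : IsOpen (U : Set (UnitaryGroup.localPi E c (k₀ + k₀) JD w)))
    {f : ℂ → UnitaryGroup.localPi E c (k₀ + k₀) JD w → ℂ} (hf : ∀ s, IsLocalSiegelSection F E c hcδ hδ hd w k₀ hT hJD χv s (f s))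
    (hfU : ∀ s g k, k ∈ U → f s (g * k) = f s g) (hfc : ∀ s, Continuous (f s)) (hdiff : ∀ g, Differentiable ℂ fun s => f s g)
    (hbd : ∀ Kc : Set (UnitaryGroup.localPi E c (k₀ + k₀) JD w), IsCompact Kc → ∀ s₀ : ℂ, ∃ r > 0, ∃ C : ℝ, ∀ s ∈ Metric.ball s₀ r, ∀ g ∈ Kc, ‖f s g‖ ≤ C)
    {β βinv : Matrix (Fin k₀) (Fin k₀) (LocalRing E w)} (hβs : (β.map (conjLocal E c w))ᵀ * LocalSplitting.gramS F E w k₀ T + LocalSplitting.gramS F E w k₀ T * β = 0)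
    (hββ : β * βinv = 1) (x : UnitaryGroup.localPi E c (k₀ + k₀) JD w) :
    ∃ K : ℕ,
      (∀ (s : ℂ) (k : ℕ), K ≤ k →
        ∫ t in {t : S | ∀ i j (w' : UnitaryGroup.PlacesOver E w), Valued.v (t.1 i j w') ≤ Valued.v (UnitaryGroup.toPlace w w' ϖ) ^ (-(k : ℤ))},
          f s (LocalSplitting.weylDelta F E c w k₀ hJD * LocalSplitting.nElem F E c w k₀ hJD t.1 ((hS t.1).1 t.2) * x) *
            ((adeleAddCharAt F w (-(Algebra.trace (w.adicCompletion F) (LocalRing E w) (Matrix.trace (β * t.1)))) : Circle) : ℂ) ∂μ =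
        ∫ t in {t : S | ∀ i j (w' : UnitaryGroup.PlacesOver E w), Valued.v (t.1 i j w') ≤ Valued.v (UnitaryGroup.toPlace w w' ϖ) ^ (-(K : ℤ))},
          f s (LocalSplitting.weylDelta F E c w k₀ hJD * LocalSplitting.nElem F E c w k₀ hJD t.1 ((hS t.1).1 t.2) * x) *
            ((adeleAddCharAt F w (-(Algebra.trace (w.adicCompletion F) (LocalRing E w) (Matrix.trace (β * t.1)))) : Circle) : ℂ) ∂μ) ∧
      Differentiable ℂ fun s : ℂ =>
        ∫ t in {t : S | ∀ i j (w' : UnitaryGroup.PlacesOver E w), Valued.v (t.1 i j w') ≤ Valued.v (UnitaryGroup.toPlace w w' ϖ) ^ (-(K : ℤ))},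
          f s (LocalSplitting.weylDelta F E c w k₀ hJD * LocalSplitting.nElem F E c w k₀ hJD t.1 ((hS t.1).1 t.2) * x) *
            ((adeleAddCharAt F w (-(Algebra.trace (w.adicCompletion F) (LocalRing E w) (Matrix.trace (β * t.1)))) : Circle) : ℂ) ∂μ := by
  -- the additive Haar measure of `F_v` and the conductor exponent of Tate's character
  letI : MeasurableSpace (w.adicCompletion F) := borel _
  haveI : BorelSpace (w.adicCompletion F) := ⟨rfl⟩
  obtain ⟨d, hdψ⟩ := exists_hasConductorExp_adeleAddCharAt F w
  -- the auxiliary data `ε`, `c_ε`, `c₂`, `b_T` (★ Φ5-data)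
  obtain ⟨ε, hεσ, hεint, cε, hε⟩ := exists_skewUnit F E c w hϖ hcδ hδ
  obtain ⟨c₂, h2⟩ := exists_two_threshold F E w hϖ
  obtain ⟨b₁, hb₁0, hb₁⟩ := exists_mball_neg F E w hϖ (LocalSplitting.gramS F E w k₀ T)
  obtain ⟨b₂, hb₂0, hb₂⟩ := exists_mball_neg F E w hϖ (LocalSplitting.gramS F E w k₀ T)⁻¹
  have hTb : ∀ i j (w' : UnitaryGroup.PlacesOver E w), Valued.v (LocalSplitting.gramS F E w k₀ T i j w') ≤ Valued.v (UnitaryGroup.toPlace w w' ϖ) ^ (-(b₁ + b₂)) :=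
    mball_antitone F E w hϖ (by omega) hb₁
  have hTib : ∀ i j (w' : UnitaryGroup.PlacesOver E w), Valued.v ((LocalSplitting.gramS F E w k₀ T)⁻¹ i j w') ≤ Valued.v (UnitaryGroup.toPlace w w' ϖ) ^ (-(b₁ + b₂)) :=
    mball_antitone F E w hϖ (by omega) hb₂
  -- the right-translated family `g ↦ f s (g·x)`: Siegel, of level `x U x⁻¹`, continuous
  have hfx : ∀ s, IsLocalSiegelSection F E c hcδ hδ hd w k₀ hT hJD χv s (fun g => f s (g * x)) := fun s p hp g => by
    show f s (p * g * x) = _ * f s (g * x)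
    rw [mul_assoc]
    exact hf s p hp (g * x)
  have hconj : Continuous ((MulAut.conj x⁻¹).toMonoidHom : UnitaryGroup.localPi E c (k₀ + k₀) JD w →* UnitaryGroup.localPi E c (k₀ + k₀) JD w) :=
    (continuous_const.mul continuous_id).mul continuous_const
  have hUx : IsOpen ((U.comap (MulAut.conj x⁻¹).toMonoidHom : Subgroup (UnitaryGroup.localPi E c (k₀ + k₀) JD w)) : Set (UnitaryGroup.localPi E c (k₀ + k₀) JD w)) :=
    hU.preimage hconj
  have hfUx : ∀ s g k, k ∈ U.comap (MulAut.conj x⁻¹).toMonoidHom → (fun g => f s (g * x)) (g * k) = (fun g => f s (g * x)) g := by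
    intro s g k hk
    have hk' : x⁻¹ * k * x⁻¹⁻¹ ∈ U := Subgroup.mem_comap.1 hk
    rw [inv_inv] at hk'
    show f s (g * k * x) = f s (g * x)
    rw [show g * k * x = g * x * (x⁻¹ * k * x) by group]
    exact hfU s (g * x) _ hk'
  have hfxc : ∀ s, Continuous fun g => f s (g * x) := fun s => (hfc s).comp (continuous_id.mul continuous_const)
  -- ★ Φ5: Karel's lemma for the right-translated family, with Tate's character and trace
  obtain ⟨K₁, hK₁⟩ := whittaker_setIntegral_ball_eq F E c hcδ hδ hd w k₀ hT hTd hJD hϖ S hS μ MeasureTheory.Measure.addHaar hχv hUx hfx hfUx hfxc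
    (continuous_adeleAddCharAt F w) hdψ (τ := fun z => Algebra.trace (w.adicCompletion F) (LocalRing E w) z)
    (toLocalRing_algebraTrace E w c hcδ hδ) (fun r r' => map_add _ r r') (algebraTrace_toLocalRing_mul E w) (continuous_algebraTrace_localRing E w)
    hεσ hεint hε h2 hTb hTib
  -- the ball exponents `b ≥ 2 b_T`, `b′` of `β`, `β⁻¹`
  obtain ⟨b₀, hb₀0, hb₀⟩ := exists_mball_neg F E w hϖ β
  obtain ⟨b', hb'0, hb'⟩ := exists_mball_neg F E w hϖ βinv
  have hβb : ∀ i j (w' : UnitaryGroup.PlacesOver E w), Valued.v (β i j w') ≤ Valued.v (UnitaryGroup.toPlace w w' ϖ) ^ (-(b₀ + 2 * (b₁ + b₂))) :=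
    mball_antitone F E w hϖ (by omega) hb₀
  have key := hK₁ (b₀ + 2 * (b₁ + b₂)) b' β βinv (by omega) hb'0 (by omega) hβs hββ hβb hb'
  refine ⟨(K₁ + 4 * (b₀ + 2 * (b₁ + b₂)) + 2 * b' - 1).toNat, fun s k hk => ?_, ?_⟩
  · exact (key s (k : ℤ) (by omega)).trans (key s ((K₁ + 4 * (b₀ + 2 * (b₁ + b₂)) + 2 * b' - 1).toNat : ℤ) (by omega)).symm
  · -- ★ Φ5 `differentiable_whittaker`, its `hbd` letter on the compact image of the ball under `t ↦ w_Δ n(t) x`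
    have hcont : Continuous fun t : S => (fun g => g * x) (LocalSplitting.weylDelta F E c w k₀ hJD * LocalSplitting.nElem F E c w k₀ hJD t.1 ((hS t.1).1 t.2)) :=
      K2LiuSkewLatticeShells.continuous_pullback (F := F) (E := E) (c := c) (v := w) (n := k₀) (hJD := hJD) (S := S) (hS := hS) (f := fun g => g * x)
        (continuous_id.mul continuous_const)
    exact differentiable_whittaker F E c w k₀ hJD hϖ S hS μ hfxc (fun g => hdiff (g * x)) (-((K₁ + 4 * (b₀ + 2 * (b₁ + b₂)) + 2 * b' - 1).toNat : ℤ))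
      (fun s₀ => by
        obtain ⟨r, hr, C, hC⟩ := hbd _ ((K2LiuSkewLatticeShells.isCompact_ball F E c w hϖ k₀ S hS
          (-((K₁ + 4 * (b₀ + 2 * (b₁ + b₂)) + 2 * b' - 1).toNat : ℤ))).image hcont) s₀
        exact ⟨r, hr, C, fun s hs t ht => hC s hs _ ⟨t, ht, rfl⟩⟩)
      (continuous_adeleAddCharAt F w) (continuous_algebraTrace_localRing E w) β

end Summit.HodgeConjecture.HodgeConjecture.Cruxes.HLiu418.K2LiuBadPlaceWhittakerRightTranslate

end
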